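import Literature.Barriers.AtomisticToContinuum.OneDimensionalHardCoreRodsSign
import Literature.Barriers.AtomisticToContinuum.OneDimensionalHardCoreRodsAdjugate
import Literature.Barriers.AtomisticToContinuum.OneDimensionalHardCoreRodsContraction
import Literature.Barriers.AtomisticToContinuum.OneDimensionalHardCoreRodsDeficiency
import HarnessLib

/-!
# Hard rods, Parts D′–G′ assembled: Lenard's rod formula and the Gaussian bound in compressed coordinates

`Literature/Barriers/AtomisticToContinuum/` (D-0021 barrier catalogue), sub-problem
`BoseEinsteinCondensation`; part of the typed proof of the rod barrier `OneDimensionalHardRods`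
(`OneDimensionalHardCoreRods.lean`, eighth audit of `OneDimensionalHardCore`, 2026-08-16).

The compressed-coordinate density of the rod problem at tagged displacement `t`,
`ρ̃_{n+1}(t) = (n+1) ∫_{D_t^n} Ψ_TG(w, 0) Ψ_TG(T_t w, t) dw` (`rodCompressedDensity`; the tagged
point particle at `0` and at `t` on the compressed ring `[0, L']`, spectators in
`D_t = [0,t−a] ∪ (t,L']`, crossed ones shifted by `a`), satisfies LENARD'S ROD FORMULA
`ρ̃_{n+1}(t) = L'⁻¹ e^{iπnt/L'} ⟨u(t), adj(A(t)) u(0)⟩` with `A(t) = rodMatrix n L' a t`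
(`rodCompressedDensity_eq_adjugate`: Part D′ `rod_sgn_det_det_eq_girardeau`, Part C′
`integral_weight_det_det_shift`, Part E′ `gramShift_rod_eq_smul`), hence the GAUSSIAN BOUND
`0 ≤ ρ̃_{n+1}(t) ≤ ((n+1)/L') e^{1/4} exp(−∑_l |1+c_l|² sin²(π(t−a)/L')/(144π²(l+1)))`
(`rodCompressedDensity_le`: Part F′ `norm_star_dotProduct_adjugate_mulVec_le_of_contraction`,
Part F″ `sum_norm_sq_rodMatrix_mulVec_le`, Part G′ `deficiency_lower_bound`). At `a = 0` this is
the Proofs file's `girardeauDensityMatrix_le_exp_numVar` with `L'` for `L` (up to constants).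

## References

* [ForresterEtAl2003] P. J. Forrester et al., Phys. Rev. A 67 (2003) 043607: §2.1.2.
* [MazzantiEtAl2008] F. Mazzanti et al., Phys. Rev. Lett. 100 (2008) 020401: Eqs. (2)–(3).
-/

noncomputable section

open MeasureTheory Finset Complex Matrix
open scoped BigOperators Real ComplexConjugate

namespace Literature.Barriers.AtomisticToContinuum.BoseGas

section CompressedDensity

variable {n : ℕ} {Lp a t : ℝ}

/-- The **compressed-coordinate rod density** at tagged displacement `t`:
`ρ̃_{n+1}(t) = (n+1) ∫_{D_t^n} Ψ_TG(w, 0) Ψ_TG(T_t w, t) dw` (Girardeau states of `n + 1` point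
particles on the compressed ring `L'`; spectators in the compressed domain, crossed ones shifted by
the rod length). [cite: MazzantiEtAl2008, Eqs. (2)–(3)] -/
def rodCompressedDensity (n : ℕ) (Lp a t : ℝ) : ℝ :=
  (n + 1 : ℝ) * ∫ w in Set.pi Set.univ (fun _ : Fin n => rodDomain Lp a t),
    girardeauState (n + 1) Lp (Fin.snoc w 0) *
      girardeauState (n + 1) Lp (Fin.snoc (fun i => rodShift a t (w i)) t)

/-- `ρ̃ ≥ 0`. [folklore] -/
theorem rodCompressedDensity_nonneg (n : ℕ) (Lp a t : ℝ) : 0 ≤ rodCompressedDensity n Lp a t := by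
  unfold rodCompressedDensity
  refine mul_nonneg (by positivity) (integral_nonneg fun w => ?_)
  exact mul_nonneg (girardeauState_nonneg _ _ _) (girardeauState_nonneg _ _ _)

/-- **Lenard's rod formula.** For `0 ≤ a ≤ t ≤ L'`,
`ρ̃_{n+1}(t) = L'⁻¹ (e^{−iπt/L'})^{−n} ⟨u(t), adj(A(t)) u(0)⟩`, `A(t)` Lenard's rod matrix.
[cite: ForresterEtAl2003, §2.1.2] -/
theorem rodCompressedDensity_eq_adjugate (hLp : 0 < Lp) (ha : 0 ≤ a) (hat : a ≤ t) (htL : t ≤ Lp) :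
    (rodCompressedDensity n Lp a t : ℂ) =
      (Lp : ℂ)⁻¹ * ((cexp (-(↑(π * t / Lp) * I)) ^ n)⁻¹ *
        (star (uVec n Lp t) ⬝ᵥ ((rodMatrix n Lp a t).adjugate *ᵥ uVec n Lp 0))) := by
  have hdef : rodCompressedDensity n Lp a t = (n + 1 : ℝ) *
      ∫ w in Set.pi Set.univ (fun _ : Fin n => rodDomain Lp a t),
        girardeauState (n + 1) Lp (Fin.snoc w 0) *
          girardeauState (n + 1) Lp (Fin.snoc (fun i => rodShift a t (w i)) t) := rfl
  rw [hdef, Complex.ofReal_mul, ← integral_complex_ofReal]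
  have hS : MeasurableSet (Set.pi Set.univ fun _ : Fin n => rodDomain Lp a t) :=
    MeasurableSet.univ_pi fun _ => measurableSet_rodDomain Lp a t
  set Φ : ℂ := cexp (-(↑(π * t / Lp) * I)) with hΦ
  set C2 : ℝ := ((n + 1).factorial : ℝ) * Lp ^ (n + 1) with hC2def
  have hC2 : (C2 : ℂ) ≠ 0 := by
    have : C2 ≠ 0 := by positivity
    exact_mod_cast this
  have hΦ0 : Φ ^ n ≠ 0 := pow_ne_zero _ (Complex.exp_ne_zero _)
  have hL0 : (Lp : ℂ) ≠ 0 := by exact_mod_cast hLp.ne'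
  have hpt : ∀ w ∈ Set.pi Set.univ (fun _ : Fin n => rodDomain Lp a t),
      ((girardeauState (n + 1) Lp (Fin.snoc w 0) *
          girardeauState (n + 1) Lp (Fin.snoc (fun i => rodShift a t (w i)) t) : ℝ) : ℂ) =
      (C2 : ℂ)⁻¹ * (Φ ^ n)⁻¹ * ((∏ j, rodWeight n Lp a t (w j)) *
        (det (vandermonde fun j => eL Lp ((Fin.cons 0 w : Fin (n + 1) → ℝ) j)) *
          conj (det (vandermonde fun j =>
            eL Lp ((Fin.cons t (fun i => rodShift a t (w i)) : Fin (n + 1) → ℝ) j))))) := by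
    intro w hw
    have hw' : ∀ j, w j ∈ rodDomain Lp a t := fun j => hw j (Set.mem_univ _)
    rw [rod_sgn_det_det_eq_girardeau hLp ha hat htL w hw', ← hC2def]
    field_simp
    ring
  rw [setIntegral_congr_fun hS hpt, integral_const_mul]
  have hμ : (volume : Measure (Fin n → ℝ)).restrict (Set.pi Set.univ fun _ => rodDomain Lp a t) =
      Measure.pi fun _ : Fin n => (volume : Measure ℝ).restrict (rodDomain Lp a t) := by
    rw [volume_pi, Measure.restrict_pi_pi]
  rw [hμ, integral_weight_det_det_shift _ Lp 0 t (measurable_rodWeight n Lp a t)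
      (norm_rodWeight_le n Lp a t) (measurable_rodShift a t),
    gramShift_rod_eq_smul hLp ha hat htL, adjugate_smul, Fintype.card_fin, Nat.add_sub_cancel,
    smul_mulVec, dotProduct_smul, smul_eq_mul]
  set B : ℂ := star (uVec n Lp t) ⬝ᵥ ((rodMatrix n Lp a t).adjugate *ᵥ uVec n Lp 0)
  have hn0 : ((n : ℂ) + 1) ≠ 0 := by exact_mod_cast Nat.succ_ne_zero n
  have hnf : (n.factorial : ℂ) ≠ 0 := by exact_mod_cast Nat.factorial_ne_zero n
  have key : (((n : ℝ) + 1 : ℝ) : ℂ) * (C2 : ℂ)⁻¹ * (n.factorial : ℂ) * (Lp : ℂ) ^ n =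
      (Lp : ℂ)⁻¹ := by
    rw [hC2def, Nat.factorial_succ]
    push_cast
    field_simp
    ring
  calc (((n : ℝ) + 1 : ℝ) : ℂ) * ((C2 : ℂ)⁻¹ * (Φ ^ n)⁻¹ * ((n.factorial : ℂ) * ((Lp : ℂ) ^ n * B)))
      = ((((n : ℝ) + 1 : ℝ) : ℂ) * (C2 : ℂ)⁻¹ * (n.factorial : ℂ) * (Lp : ℂ) ^ n) *
          ((Φ ^ n)⁻¹ * B) := by ring
    _ = (Lp : ℂ)⁻¹ * ((Φ ^ n)⁻¹ * B) := by rw [key]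

/-- The **phase-weighted harmonic sum** of the rod problem,
`S_{n+1}(a, L') = ∑_{l ≤ n} |1 + c_l|² / (l + 1)` (`= 4 H_{n+1}` at `a = 0`). [folklore] -/
def rodHarmonic (n : ℕ) (Lp a : ℝ) : ℝ :=
  ∑ l : Fin (n + 1), ‖1 + rodPhase n Lp a l‖ ^ 2 / ((l : ℕ) + 1)

/-- `S ≥ 0`. [folklore] -/
theorem rodHarmonic_nonneg (n : ℕ) (Lp a : ℝ) : 0 ≤ rodHarmonic n Lp a :=
  Finset.sum_nonneg fun l _ => by positivity

/-- **The Gaussian bound in compressed coordinates.** For `0 ≤ a ≤ t ≤ L'`,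
`ρ̃_{n+1}(t) ≤ ((n+1)/L') e^{1/4} exp(−sin²(π(t−a)/L') S_{n+1} / (144π²))`.
[cite: ForresterEtAl2003, §2.1.4] -/
theorem rodCompressedDensity_le (hLp : 0 < Lp) (ha : 0 ≤ a) (hat : a ≤ t) (htL : t ≤ Lp) :
    rodCompressedDensity n Lp a t ≤
      (n + 1 : ℝ) / Lp * Real.exp (1 / 4) *
        Real.exp (-(Real.sin (π * (t - a) / Lp) ^ 2 * rodHarmonic n Lp a / (144 * π ^ 2))) := by
  have hρ := rodCompressedDensity_eq_adjugate (n := n) hLp ha hat htL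
  set A := rodMatrix n Lp a t with hAdef
  set B : ℂ := star (uVec n Lp t) ⬝ᵥ (A.adjugate *ᵥ uVec n Lp 0) with hB
  set Φ : ℂ := cexp (-(↑(π * t / Lp) * I)) with hΦ
  have hΦ1 : ‖Φ‖ = 1 := by
    rw [hΦ, show -(((π * t / Lp : ℝ) : ℂ) * I) = ((-(π * t / Lp) : ℝ) : ℂ) * I by push_cast; ring,
      norm_exp_ofReal_mul_I]
  have hΦn : ‖(Φ ^ n)⁻¹‖ = 1 := by
    rw [norm_inv, norm_pow, hΦ1, one_pow, inv_one]
  have hnorm : ‖(rodCompressedDensity n Lp a t : ℂ)‖ = Lp⁻¹ * ‖B‖ := by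
    rw [hρ, norm_mul, norm_mul, hΦn, one_mul, norm_inv, Complex.norm_real, Real.norm_eq_abs,
      abs_of_pos hLp]
  -- the adjugate bound for the contraction `A`
  have hcontr : ∀ v : Fin (n + 1) → ℂ, ∑ i, ‖(A *ᵥ v) i‖ ^ 2 ≤ ∑ i, ‖v i‖ ^ 2 := fun v =>
    sum_norm_sq_rodMatrix_mulVec_le hLp ha hat htL v
  have hadj := norm_star_dotProduct_adjugate_mulVec_le_of_contraction hcontr (uVec n Lp t)
    (uVec n Lp 0)
  rw [sum_norm_sq_uVec, sum_norm_sq_uVec, Fintype.card_fin, ← Real.sqrt_mul (by positivity),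
    Real.sqrt_mul_self (by positivity)] at hadj
  -- the deficiency bound
  have hdef := deficiency_lower_bound (n := n) hLp ha hat htL
  have hexp : Real.exp ((∑ i, ∑ j, ‖A i j‖ ^ 2 - ((n + 1 : ℕ) : ℝ)) / 4) ≤
      Real.exp (-(Real.sin (π * (t - a) / Lp) ^ 2 * rodHarmonic n Lp a / (144 * π ^ 2))) := by
    apply Real.exp_le_exp.mpr
    have hsum : Real.sin (π * (t - a) / Lp) ^ 2 * rodHarmonic n Lp a / (144 * π ^ 2) =
        (∑ l : Fin (n + 1), ‖1 + rodPhase n Lp a l‖ ^ 2 * Real.sin (π * (t - a) / Lp) ^ 2 /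
          (36 * π ^ 2 * ((l : ℕ) + 1))) / 4 := by
      unfold rodHarmonic
      rw [Finset.mul_sum, Finset.sum_div, Finset.sum_div]
      refine Finset.sum_congr rfl fun l _ => ?_
      field_simp
      ring
    rw [hsum]
    push_cast at hdef ⊢
    linarith
  calc rodCompressedDensity n Lp a t
      ≤ ‖(rodCompressedDensity n Lp a t : ℂ)‖ := by
        rw [Complex.norm_real, Real.norm_eq_abs]; exact le_abs_self _
    _ = Lp⁻¹ * ‖B‖ := hnorm
    _ ≤ Lp⁻¹ * (Real.exp (1 / 4) *
          Real.exp ((∑ i, ∑ j, ‖A i j‖ ^ 2 - ((n + 1 : ℕ) : ℝ)) / 4) * (n + 1 : ℝ)) := by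
        refine mul_le_mul_of_nonneg_left ?_ (inv_nonneg.mpr hLp.le)
        exact_mod_cast hadj
    _ ≤ Lp⁻¹ * (Real.exp (1 / 4) *
          Real.exp (-(Real.sin (π * (t - a) / Lp) ^ 2 * rodHarmonic n Lp a / (144 * π ^ 2))) *
            (n + 1 : ℝ)) := by
        gcongr
    _ = (n + 1 : ℝ) / Lp * Real.exp (1 / 4) *
          Real.exp (-(Real.sin (π * (t - a) / Lp) ^ 2 * rodHarmonic n Lp a / (144 * π ^ 2))) := by
        ring

end CompressedDensity

end Literature.Barriers.AtomisticToContinuum.BoseGas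

end
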